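import Summits.QuantumFields.YangMills.Theorems.CurvatureBoostCovariance.Negative.OnAllTestsFalse
import Summits.QuantumFields.YangMills.Theses.PencilRigidity

/-!
# Negative results on `PencilRigidity.NPointIsotropy`, VI: invariance as equality of functionals on all of `𝓢`
is FALSE

Sixth file of the standing disprover's analysis of crux stmt-QuantumFields-11686 (refuter, cdisprove, cycle 2).

`NPointIsotropyOnAllTests` is the crux with `IsOffDiagonal F →` deleted from its CONCLUSION (planar-rotation
invariance of every `𝔖ₙ` as an identity of functionals on `𝓢`, not only on `⁰𝒮`), hypotheses verbatim; it implies
the crux (`nPointIsotropy_of_onAllTests`). `not_NPointIsotropyOnAllTests` refutes it with the witness of the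
sibling crux `CurvatureBoostCovariance` (landed `VacuumSharp` / `OnAllTestsFalse`): `G = SU(2)`, the fundamental
representation, the zero scheme and `S♯` = vacuum family + (degree 3) evaluation at the constant configuration
`(e₁,e₁,e₁)`. Every hypothesis of the crux reads `S₁` on `⁰𝒮`, on time-ordered data or in degree `0`, where `S♯`
is the vacuum (`hypotheses_sharp`); the radial-kernel hypothesis holds with `K = 0` (`S♯₂ = 0`); and the half-turn
`diag(-1,-1,1,1)` of the `(x₀,x₁)`-plane (determinant `1`, fixes `e₂, e₃`) moves the bump at `(e₁,e₁,e₁)` to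
`(-e₁,-e₁,-e₁)`: `S♯₃(bump ∘ halfTurn⁻¹) = 0 ≠ 1 = S♯₃(bump)`.

MESSAGE TO PROVERS: state and prove invariance ON `⁰𝒮` only — nothing (not the tie, not E2 in sixteen frames, not
the radial kernel) pins a tied family at coincident points.
-/

noncomputable section

namespace Summit.QuantumFields.YangMills.Theorems.NPointIsotropy.Negative

open scoped SchwartzMap
open MeasureTheory Filter Topology
open Literature.MathematicalPhysics.QuantumLattice Literature.MathematicalPhysics.AQFT
  Literature.MathematicalPhysics.QuantumFieldTheory
open Summit.QuantumFields.YangMills.Theorems.CurvatureBoostCovariance.Negative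
  (W1 EightFrameRP PlanarInvariantOnAllTests vac sharp hypotheses_sharp sharp_of_ne vac_of_ne_zero
    sharp_three_apply halfTurn det_halfTurn halfTurn_single_two halfTurn_single_three halfTurn_symm_e1
    exists_bump_three)

/-- **The natural strengthening of the crux**: same hypotheses (`W₁`, RP in the eight frames, the radial
two-point kernel), conclusion on ALL test functions (`PlanarInvariantOnAllTests`: no restriction to `⁰𝒮`). -/
def NPointIsotropyOnAllTests : Prop :=
  ∀ (G : Type) [Group G] [TopologicalSpace G] [IsTopologicalGroup G] [CompactSpace G],
    IsCompactSimpleLieGroup G →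
    letI : MeasurableSpace G := borel G
    haveI : BorelSpace G := ⟨rfl⟩
    ∀ (r : LatticeRep G) (sch : SpeciesScheme (YMSpecies G))
      (S₁ : SchwingerFamily (EuclideanSpace ℝ (Fin 4))),
      W1 r sch S₁ → EightFrameRP S₁ →
      (∃ K : EuclideanSpace ℝ (Fin 4) → ℝ, ContinuousOn K {x : EuclideanSpace ℝ (Fin 4) | x ≠ 0} ∧
        (∀ (R : EuclideanSpace ℝ (Fin 4) ≃ₗᵢ[ℝ] EuclideanSpace ℝ (Fin 4)) (x : EuclideanSpace ℝ (Fin 4)),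
          x ≠ 0 → K (R x) = K x) ∧
        ∀ F : 𝓢((Fin 2 → EuclideanSpace ℝ (Fin 4)), ℂ), IsOffDiagonal F →
          MeasureTheory.Integrable
            (fun x : Fin 2 → EuclideanSpace ℝ (Fin 4) => (K (x 0 - x 1) : ℂ) * F x) ∧
          S₁ 2 F = ∫ x : Fin 2 → EuclideanSpace ℝ (Fin 4), (K (x 0 - x 1) : ℂ) * F x) →
      PlanarInvariantOnAllTests S₁

/-- The strengthening implies the crux (restrict the conclusion to `⁰𝒮`). [folklore] -/
theorem nPointIsotropy_of_onAllTests (h : NPointIsotropyOnAllTests) :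
    Summit.QuantumFields.YangMills.Theses.PencilRigidity.NPointIsotropy := by
  intro G _ _ _ _ hG W₁ r sch S₁ hW h8 hK R hR h2 h3 n F _
  exact h G hG r sch S₁ hW h8 hK R hR h2 h3 n F

/-- `S♯` has the radial two-point kernel `K = 0`: `S♯₂ = vac₂ = 0`. [folklore] -/
theorem sharp_radialKernel :
    ∃ K : EuclideanSpace ℝ (Fin 4) → ℝ, ContinuousOn K {x : EuclideanSpace ℝ (Fin 4) | x ≠ 0} ∧
      (∀ (R : EuclideanSpace ℝ (Fin 4) ≃ₗᵢ[ℝ] EuclideanSpace ℝ (Fin 4)) (x : EuclideanSpace ℝ (Fin 4)),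
        x ≠ 0 → K (R x) = K x) ∧
      ∀ F : 𝓢((Fin 2 → EuclideanSpace ℝ (Fin 4)), ℂ), IsOffDiagonal F →
        MeasureTheory.Integrable
          (fun x : Fin 2 → EuclideanSpace ℝ (Fin 4) => (K (x 0 - x 1) : ℂ) * F x) ∧
        sharp 2 F = ∫ x : Fin 2 → EuclideanSpace ℝ (Fin 4), (K (x 0 - x 1) : ℂ) * F x := by
  refine ⟨fun _ => 0, continuousOn_const, fun _ _ _ => rfl, fun F _ => ⟨by simp, ?_⟩⟩
  rw [sharp_of_ne (by decide : (2 : ℕ) ≠ 3), vac_of_ne_zero two_ne_zero]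
  simp

/-- **THE NATURAL STRENGTHENING IS FALSE**: with the conclusion stated on ALL test functions the crux fails —
`G = SU(2)`, `r` = fundamental representation, the zero scheme, `S₁ = S♯`, `K = 0`, the half-turn of the
`(x₀,x₁)`-plane and the bump at `(e₁,e₁,e₁)`: `S♯₃(bump ∘ halfTurn⁻¹) = bump(-e₁,-e₁,-e₁) = 0 ≠ 1 = S♯₃(bump)`.
[folklore] -/
theorem not_NPointIsotropyOnAllTests : ¬ NPointIsotropyOnAllTests := by
  intro h
  have hG : IsCompactSimpleLieGroup (Matrix.specialUnitaryGroup (Fin 2) ℂ) :=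
    isCompactSimpleLieGroup_specialUnitaryGroup isSimpleCompactGroup_specialUnitaryGroup_holds le_rfl
  letI : MeasurableSpace (Matrix.specialUnitaryGroup (Fin 2) ℂ) := borel _
  haveI : BorelSpace (Matrix.specialUnitaryGroup (Fin 2) ℂ) := ⟨rfl⟩
  let r : LatticeRep (Matrix.specialUnitaryGroup (Fin 2) ℂ) :=
    ⟨2, fundamentalRep (Fin 2), continuous_fundamentalRep _, fundamentalRep_injective _,
      fundamentalRep_mem_unitaryGroup⟩
  obtain ⟨hW, h8, -, -⟩ := hypotheses_sharp r
  have key := h (Matrix.specialUnitaryGroup (Fin 2) ℂ) hG r (SpeciesScheme.zero _) sharp hW h8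
    sharp_radialKernel halfTurn det_halfTurn halfTurn_single_two halfTurn_single_three 3
  obtain ⟨F, hF1, hF0⟩ := exists_bump_three
  have h1 := key F
  rw [sharp_three_apply, sharp_three_apply, linActMulti_apply] at h1
  simp only [halfTurn_symm_e1] at h1
  rw [hF0, hF1] at h1
  exact zero_ne_one h1

end Summit.QuantumFields.YangMills.Theorems.NPointIsotropy.Negative

end
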